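import Summits.ResolutionOfSingularities.ResolutionOfSingularities.Theorems.WildQuotientsSummitReductionStubPairOrbitNormalFormBlowupCentreFormalIdeal
import Literature.AlgebraicGeometry.Resolution.AlterationsNormalFormStrictTransformProofs
import HarnessLib

/-!
# `WildQuotients.SummitReduction` (stmt-ResolutionOfSingularities-16324), line `FramePerfect`, stub S
# (`stub_pair_orbitNormalFormBlowup`): sub-goal (O2) — the strict transforms of the orbits of the
# other singular components are regular

Route `ResolutionOfSingularities/WildQuotients`, crux `SummitReduction`; helper file of the line
skeleton (v8), stub S = the orbit version of de Jong 1996, Claim 4.27 for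
`DeJong1997.QuasiSplitNormalFormPair`. This file PROVES the sub-goal (O2) of
`quasiSplitNormalFormPair_blowup_of_overCentre` (`…OrbitNormalFormBlowupReduction.lean`): for an
equivariant blow-up `π : X' → X` of a `QuasiSplitNormalFormPair` in the orbit centre
`C = closure (⋃_g ρ(g)(E))` and a component `E' ⊄ C` of `Sing X`, the strict transform of the
orbit `⋃_g ρ(g)(E')`, with its reduced structure, is a regular scheme — de Jong 1996, 4.27
(p. 75): "Let `Ẽ' ⊂ X'` be the strict transform of `E'`. This equals the blowing up of `E'` in the
nonsingular closed subscheme `E' ∩ E` (scheme-theoretically), hence `Ẽ'` is nonsingular", made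
equivariant (de Jong 1997, 5.11 ¶3) and coefficient-free:

* `isRegularLocalRing_nodeDeformationRing_quotient_centreIdeal_sup` — in the model
  `A⟦u, v⟧/(uv - h)`, `h ∈ (t_{a₀}, t_{b₀})`, the quotient by `𝔭_{a₀b₀} + 𝔭_{ab}` is
  `A/(t_{a₀}, t_{b₀}, t_a, t_b)`, a regular local ring;
* `quasiSplitNormalFormPair_centreIntersection_orbit` — "the nonsingular closed subscheme
  `E' ∩ E`" for ORBITS: the closed subscheme of the reduced orbit `C'` of `E'` cut out by the
  ideal sheaf of the orbit `C` of `E` is regular (at a closed point its local ring is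
  `𝒪_{X,x}/(I(C)_x + I(C')_x)`, whose completion is the model modulo `𝔭_{a₀b₀} + 𝔭_{ab}` by the
  dictionary `quasiSplitNormalFormPair_centreFormalIdeal`; flat descent of regularity; Jacobson);
* `quasiSplitNormalFormPair_isRegular_strictTransform_orbit` — **(O2)**: the blow-up of the
  regular `C'` (field `isRegular_subscheme_orbit`) in `C ∩ C'` is regular (Liu 8.1.19 (a),
  `IsBlowup.isRegular_of_isRegular_subscheme`), embeds into `X'` as a closed subscheme
  (GW 13.96 (2), `StrictTransformClosedImmersion_holds`) with image the strict transform of `C'`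
  (`IsBlowup.range_eq_strictTransformSet`), which is therefore regular with its reduced structure
  (`isRegular_subscheme_vanishingIdeal_range`).

## Sources

* A. J. de Jong, *Smoothness, semi-stability and alterations*, Publ. Math. IHÉS 83 (1996), 4.27,
  p. 75. [DeJong1996]
* A. J. de Jong, *Families of curves and alterations*, Ann. Inst. Fourier 47 (1997), proof of
  Prop. 5.11, p. 619. [DeJong1997]
* U. Görtz, T. Wedhorn, *Algebraic Geometry I* (2nd ed., 2020), Prop. 13.91, 13.96 (2). [GortzWedhorn2020]
* Q. Liu, *Algebraic Geometry and Arithmetic Curves* (2002), Thm. 8.1.19 (a). [Liu2002]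
-/

set_option linter.dupNamespace false -- the tree's summit namespace repeats `ResolutionOfSingularities`

noncomputable section

open CategoryTheory CategoryTheory.Limits AlgebraicGeometry TopologicalSpace Topology
open Literature.AlgebraicGeometry.Resolution
open Literature.AlgebraicGeometry
open IsLocalRing Scheme.IdealSheafData

namespace Summit.ResolutionOfSingularities.ResolutionOfSingularities.Theorems

/-! ## The model modulo two centre ideals -/

/-- **`A⟦u, v⟧/(uv - h)` modulo `𝔭_{a₀b₀} + 𝔭_{ab}` is the regular local ring
`A/(t_{a₀}, t_{b₀}, t_a, t_b)`** (`h ∈ (t_{a₀}, t_{b₀})`, `t` a regular system of parameters of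
the regular local `A`) — de Jong's "nonsingular closed subscheme `E' ∩ E`" read in the
coefficient-free rings of 4.25 (ii). [cite: DeJong1996, 4.27, p. 75] -/
theorem isRegularLocalRing_nodeDeformationRing_quotient_centreIdeal_sup {A : Type} [CommRing A]
    [IsRegularLocalRing A] {m : ℕ} (t : Fin m → A) (ht : Ideal.span (Set.range t) = maximalIdeal A)
    (hdim : ringKrullDim A = m) (h : A) {a₀ b₀ a b : Fin m} (hh : h ∈ Ideal.span {t a₀, t b₀}) :
    IsRegularLocalRing (DeJong1996.NodeDeformationRing A h ⧸
      (((Ideal.span {t a₀, t b₀}).map (DeJong1996.NodeDeformationRing.ofBase A h) ⊔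
          Ideal.span {Ideal.Quotient.mk _ (MvPowerSeries.X 0), Ideal.Quotient.mk _ (MvPowerSeries.X 1)}) ⊔
        ((Ideal.span {t a, t b}).map (DeJong1996.NodeDeformationRing.ofBase A h) ⊔
          Ideal.span {Ideal.Quotient.mk _ (MvPowerSeries.X 0),
            Ideal.Quotient.mk _ (MvPowerSeries.X 1)}))) := by
  classical
  have hrsop := isRsopPart_of_span_eq_of_ringKrullDim_eq t ht hdim
  -- the ideal `(t_{a₀}, t_{b₀}, t_a, t_b)` of `A` and the regularity of the quotient
  let F : Finset (Fin m) := {a₀, b₀, a, b}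
  set 𝔞 : Ideal A := Ideal.span (t '' (F : Set (Fin m))) with h𝔞
  have h𝔞eq : Ideal.span {t a₀, t b₀} ⊔ Ideal.span {t a, t b} = 𝔞 := by
    rw [h𝔞, ← Ideal.span_union]
    congr 1
    ext z
    simp only [F, Set.mem_union, Set.mem_insert_iff, Set.mem_singleton_iff, Set.mem_image,
      Finset.coe_insert, Finset.coe_singleton]
    constructor
    · rintro ((rfl | rfl) | (rfl | rfl))
      exacts [⟨a₀, Or.inl rfl, rfl⟩, ⟨b₀, Or.inr (Or.inl rfl), rfl⟩,
        ⟨a, Or.inr (Or.inr (Or.inl rfl)), rfl⟩, ⟨b, Or.inr (Or.inr (Or.inr rfl)), rfl⟩]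
    · rintro ⟨i, (rfl | rfl | rfl | rfl), rfl⟩
      exacts [Or.inl (Or.inl rfl), Or.inl (Or.inr rfl), Or.inr (Or.inl rfl), Or.inr (Or.inr rfl)]
  haveI hreg𝔞 : IsRegularLocalRing (A ⧸ 𝔞) := by
    let ι : Fin F.card ↪o Fin m := F.orderEmbOfFin rfl
    have h1 := (hrsop.comp ι ι.injective).isRegularLocalRing_quotient
    have hrange : Set.range (t ∘ ι) = t '' (F : Set (Fin m)) := by
      rw [Set.range_comp, Finset.range_orderEmbOfFin]
    rwa [hrange] at h1
  -- the surjection onto `A/𝔞` and its kernel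
  have hh' : h ∈ 𝔞 := by
    rw [← h𝔞eq]
    exact Ideal.mem_sup_left hh
  obtain ⟨ψ, hψs, hψk, -⟩ := exists_ringHom_nodeDeformationRing_quotient h 𝔞 hh'
  have hker : ((Ideal.span {t a₀, t b₀}).map (DeJong1996.NodeDeformationRing.ofBase A h) ⊔
        Ideal.span {Ideal.Quotient.mk _ (MvPowerSeries.X 0), Ideal.Quotient.mk _ (MvPowerSeries.X 1)}) ⊔
      ((Ideal.span {t a, t b}).map (DeJong1996.NodeDeformationRing.ofBase A h) ⊔
        Ideal.span {Ideal.Quotient.mk _ (MvPowerSeries.X 0), Ideal.Quotient.mk _ (MvPowerSeries.X 1)}) =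
      RingHom.ker ψ := by
    rw [hψk, ← h𝔞eq, Ideal.map_sup, sup_sup_sup_comm, sup_idem]
  exact IsRegularLocalRing.of_ringEquiv
    ((Ideal.quotEquivOfEq hker).trans (RingHom.quotientKerEquivOfSurjective hψs)).symm

/-! ## "The nonsingular closed subscheme `E' ∩ E`" for orbits -/

/-- **The scheme-theoretic intersection of two orbit closures of singular components is
regular** (de Jong 1996, 4.27: "the nonsingular closed subscheme `E' ∩ E`
(scheme-theoretically)", orbit version): for irreducible components `E`, `E₁` of `Sing X` of a
`QuasiSplitNormalFormPair`, the closed subscheme of the reduced orbit closure `C₁` of `E₁` cut out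
by the ideal sheaf of the orbit closure `C` of `E` is a regular scheme. At a closed point
`x₀ ∈ C ∩ C₁` its local ring is `R/(P + P₁)`, `R = 𝒪_{X,x₀}`, `P = I(C)_{x₀}`, `P₁ = I(C₁)_{x₀}`
(`nonempty_stalkQuotientComapEquiv`); its completion `R̂/(P + P₁)R̂` is carried by the model `e` of
4.25 (ii) at `x₀` onto the model modulo `𝔭_{a₀b₀} + 𝔭_{ab}` (the dictionary
`quasiSplitNormalFormPair_centreFormalIdeal` applied to the translates of `E`, `E₁` through `x₀`,
`quasiSplitNormalFormPair_centreFormalIdeal_orbit`), which is regular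
(`isRegularLocalRing_nodeDeformationRing_quotient_centreIdeal_sup`); regularity descends from the
completion and generises from the closed points (`C₁` is Jacobson).
[cite: DeJong1996, 4.27, p. 75] [cite: DeJong1997, proof of Prop. 5.11, p. 619] -/
theorem quasiSplitNormalFormPair_centreIntersection_orbit {k : Type} [Field k] {X : Scheme.{0}}
    {p : X ⟶ Spec (.of k)} {Z : Set X} {G : Type} [Group G] [Finite G] {ρ : G →* Aut X} {d : ℕ}
    (hP : DeJong1997.QuasiSplitNormalFormPair p Z ρ d)
    {E E₁ : Set ↥({x : X | ¬ IsRegularLocalRing (X.presheaf.stalk x)} : Set X)}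
    (hE : E ∈ irreducibleComponents ↥({x : X | ¬ IsRegularLocalRing (X.presheaf.stalk x)} : Set X))
    (hE₁ : E₁ ∈ irreducibleComponents ↥({x : X | ¬ IsRegularLocalRing (X.presheaf.stalk x)} : Set X)) :
    Scheme.IsRegular ((vanishingIdeal ⟨closure (⋃ g : G, (ρ g).hom.base '' (Subtype.val '' E)),
        isClosed_closure⟩).comap
      (vanishingIdeal ⟨closure (⋃ g : G, (ρ g).hom.base '' (Subtype.val '' E₁)),
        isClosed_closure⟩).subschemeι).subscheme := by
  -- adapted from `DeJong1996NormalFormPairCentreIntersection.of_centreFormalIdeal` (AlterationsNormalFormCentreIntersection.lean)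
  have hS : IsClosed ({x : X | ¬ IsRegularLocalRing (X.presheaf.stalk x)} : Set X) :=
    hP.isClosed_setOf_not_isRegularLocalRing
  haveI := hP.isIntegral
  haveI := hP.locallyOfFiniteType
  haveI : IsNoetherian X := hP.isNoetherian
  set I : X.IdealSheafData := vanishingIdeal ⟨closure (⋃ g : G, (ρ g).hom.base '' (Subtype.val '' E)),
    isClosed_closure⟩ with hIdef
  set I' : X.IdealSheafData := vanishingIdeal ⟨closure (⋃ g : G, (ρ g).hom.base '' (Subtype.val '' E₁)),
    isClosed_closure⟩ with hI'def
  haveI : IsLocallyNoetherian I'.subscheme := LocallyOfFiniteType.isLocallyNoetherian I'.subschemeι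
  haveI : JacobsonSpace ↥I'.subscheme := LocallyOfFiniteType.jacobsonSpace (I'.subschemeι ≫ p)
  rw [Scheme.isRegular_subscheme_iff]
  intro z hz
  -- a closed point `z₀` of `cl{z}`
  obtain ⟨z₀, hz₀cl, hz₀c⟩ := nonempty_inter_closedPoints (Z := closure {z})
    ⟨z, subset_closure rfl⟩ isClosed_closure.isLocallyClosed
  have hzz₀ : z ⤳ z₀ := specializes_iff_mem_closure.mpr hz₀cl
  have hz₀ : z₀ ∈ (I.comap I'.subschemeι).support :=
    hzz₀.mem_closed (I.comap I'.subschemeι).support.isClosed hz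
  refine isRegularLocalRing_quotient_stalkIdeal_of_specializes _ hzz₀ hz ?_
  -- the closed point `x₀ = ι z₀` of `X` lies on `C` and on `C₁`
  set x₀ : X := I'.subschemeι z₀ with hx₀def
  have hx₀c : IsClosed ({x₀} : Set X) := by
    have h1 := I'.subschemeι.isClosedEmbedding.isClosedMap _ (mem_closedPoints_iff.mp hz₀c)
    rwa [Set.image_singleton] at h1
  have hx₀I : x₀ ∈ I.support := by
    have h1 : z₀ ∈ ((I.comap I'.subschemeι).support : Set I'.subscheme) := hz₀
    rw [support_comap] at h1
    exact h1
  have hx₀C : x₀ ∈ closure (⋃ g : G, (ρ g).hom.base '' (Subtype.val '' E)) := by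
    have h1 : x₀ ∈ (I.support : Set X) := hx₀I
    rwa [hIdef, Scheme.IdealSheafData.coe_support_vanishingIdeal] at h1
  have hx₀I' : x₀ ∈ (I'.support : Set X) := by
    rw [← range_subschemeι]
    exact ⟨z₀, rfl⟩
  have hx₀C' : x₀ ∈ closure (⋃ g : G, (ρ g).hom.base '' (Subtype.val '' E₁)) := by
    have h1 := hx₀I'
    rwa [hI'def, Scheme.IdealSheafData.coe_support_vanishingIdeal] at h1
  have hx₀S : ¬ IsRegularLocalRing (X.presheaf.stalk x₀) := hP.closure_orbit_subset E hx₀C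
  -- the local ring `R/(P + P')`
  set R := X.presheaf.stalk x₀ with hRdef
  set P : Ideal R := stalkIdeal I x₀ with hPdef
  set P' : Ideal R := stalkIdeal I' x₀ with hP'def
  have hPle : P ≤ maximalIdeal R := (mem_support_iff_stalkIdeal_le I x₀).mp hx₀I
  have hP'le : P' ≤ maximalIdeal R := (mem_support_iff_stalkIdeal_le I' x₀).mp hx₀I'
  set Q : Ideal R := P ⊔ P' with hQdef
  have hQle : Q ≤ maximalIdeal R := sup_le hPle hP'le
  haveI : Nontrivial (R ⧸ Q) :=
    Ideal.Quotient.nontrivial_iff.mpr fun hQ =>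
      (maximalIdeal.isMaximal R).ne_top (top_le_iff.mp (hQ ▸ hQle))
  haveI : IsLocalRing (R ⧸ Q) :=
    IsLocalRing.of_surjective' (Ideal.Quotient.mk Q) Ideal.Quotient.mk_surjective
  suffices hreg : IsRegularLocalRing (R ⧸ Q) by
    have hker : I'.subschemeι.ker = I' := ker_subschemeι I'
    obtain ⟨e₀⟩ := nonempty_stalkQuotientComapEquiv I'.subschemeι I z₀
    rw [hker] at e₀
    exact IsRegularLocalRing.of_ringEquiv e₀
  -- the model at `x₀` and the dictionary for the translates of `E`, `E₁` through `x₀`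
  obtain ⟨A, _, _, t, s, r, hspan, hdim, hs2, -, -, e, -, hdict, -⟩ :=
    quasiSplitNormalFormPair_centreFormalIdeal hP hx₀c hx₀S
  obtain ⟨T, hT, hx₀T, -, -, hTcompl⟩ := quasiSplitNormalFormPair_centreFormalIdeal_orbit hP hE hx₀C
  obtain ⟨T', hT', hx₀T', -, -, hT'compl⟩ := quasiSplitNormalFormPair_centreFormalIdeal_orbit hP hE₁ hx₀C'
  obtain ⟨a₀, b₀, hab₀, hb₀s, hdictT⟩ := hdict T hT hx₀T
  obtain ⟨a, b, -, -, hdictT'⟩ := hdict T' hT' hx₀T'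
  obtain ⟨U, hU, hxU, -⟩ :=
    exists_isAffineOpen_mem_and_subset (X := X) (x := x₀) (U := ⊤) (Opens.mem_top _)
  let Rh := AdicCompletion (maximalIdeal R) R
  have hPe : (P.map (algebraMap R Rh)).map e.toRingHom =
      (Ideal.span {t a₀, t b₀}).map (DeJong1996.NodeDeformationRing.ofBase A _) ⊔
        Ideal.span {Ideal.Quotient.mk _ (MvPowerSeries.X 0), Ideal.Quotient.mk _ (MvPowerSeries.X 1)} := by
    have h1 := hdictT ⟨U, hU⟩ hxU
    rwa [← hTcompl ⟨U, hU⟩ hxU, completedStalkIdeal_eq_map_stalkIdeal] at h1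
  have hP'e : (P'.map (algebraMap R Rh)).map e.toRingHom =
      (Ideal.span {t a, t b}).map (DeJong1996.NodeDeformationRing.ofBase A _) ⊔
        Ideal.span {Ideal.Quotient.mk _ (MvPowerSeries.X 0), Ideal.Quotient.mk _ (MvPowerSeries.X 1)} := by
    have h1 := hdictT' ⟨U, hU⟩ hxU
    rwa [← hT'compl ⟨U, hU⟩ hxU, completedStalkIdeal_eq_map_stalkIdeal] at h1
  have hQe : (Q.map (algebraMap R Rh)).map e.toRingHom =
      ((Ideal.span {t a₀, t b₀}).map (DeJong1996.NodeDeformationRing.ofBase A _) ⊔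
        Ideal.span {Ideal.Quotient.mk _ (MvPowerSeries.X 0), Ideal.Quotient.mk _ (MvPowerSeries.X 1)}) ⊔
      ((Ideal.span {t a, t b}).map (DeJong1996.NodeDeformationRing.ofBase A _) ⊔
        Ideal.span {Ideal.Quotient.mk _ (MvPowerSeries.X 0), Ideal.Quotient.mk _ (MvPowerSeries.X 1)}) := by
    rw [hQdef, Ideal.map_sup, Ideal.map_sup, hPe, hP'e]
  -- `(R/Q)^ ≅ R̂/QR̂ ≅ model/(𝔭_{a₀b₀} + 𝔭_{ab})` is regular, hence so is `R/Q`
  have hmem : (∏ i ∈ Finset.univ.filter (fun i : Fin (d - 1) => i.val < s), t i) ∈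
      Ideal.span {t a₀, t b₀} := by
    have ha₀s : a₀.val < s := lt_trans hab₀ hb₀s
    have ha : a₀ ∈ Finset.univ.filter (fun i : Fin (d - 1) => i.val < s) := by simp [ha₀s]
    rw [← Finset.mul_prod_erase _ _ ha]
    exact Ideal.mul_mem_right _ _ (Ideal.subset_span (by simp))
  obtain ⟨J, hJQ, hJreg⟩ : ∃ J : Ideal (DeJong1996.NodeDeformationRing A
      (∏ i ∈ Finset.univ.filter (fun i : Fin (d - 1) => i.val < s), t i)),
      (Q.map (algebraMap R Rh)).map e.toRingHom = J ∧
        IsRegularLocalRing (DeJong1996.NodeDeformationRing A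
          (∏ i ∈ Finset.univ.filter (fun i : Fin (d - 1) => i.val < s), t i) ⧸ J) :=
    ⟨_, hQe, isRegularLocalRing_nodeDeformationRing_quotient_centreIdeal_sup t hspan hdim _
      (a := a) (b := b) hmem⟩
  haveI := hJreg
  rw [RingEquiv.toRingHom_eq_coe] at hJQ
  let e₁ : (Rh ⧸ Q.map (algebraMap R Rh)) ≃+* (DeJong1996.NodeDeformationRing A
      (∏ i ∈ Finset.univ.filter (fun i : Fin (d - 1) => i.val < s), t i) ⧸ J) :=
    Ideal.quotientEquiv _ _ e hJQ.symm
  have hI : (maximalIdeal R).map (Ideal.Quotient.mk Q) = maximalIdeal (R ⧸ Q) :=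
    (maximalIdeal_quotient_eq_map Q).symm
  let φ : AdicCompletion ((maximalIdeal R).map (Ideal.Quotient.mk Q)) (R ⧸ Q) ≃+*
      (DeJong1996.NodeDeformationRing A
        (∏ i ∈ Finset.univ.filter (fun i : Fin (d - 1) => i.val < s), t i) ⧸ J) :=
    (quotientCompletionEquiv (maximalIdeal R) Q).symm.trans e₁
  exact isRegularLocalRing_of_adicCompletion_equiv
    (T := DeJong1996.NodeDeformationRing A
      (∏ i ∈ Finset.univ.filter (fun i : Fin (d - 1) => i.val < s), t i) ⧸ J) hI φ

/-! ## (O2): the strict transforms of the orbits are regular -/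

/-- **Sub-goal (O2) of `quasiSplitNormalFormPair_blowup_of_overCentre`** (de Jong 1996, 4.27:
"`Ẽ'` equals the blowing up of `E'` in the nonsingular closed subscheme `E' ∩ E`
(scheme-theoretically), hence `Ẽ'` is nonsingular", for ORBITS, de Jong 1997, 5.11 ¶3): for a
blow-up `π : X' → X` of a `QuasiSplitNormalFormPair` in the orbit centre
`C = closure (⋃_g ρ(g)(E))` and a component `E' ⊄ C` of `Sing X`, the strict transform of the
orbit `⋃_g ρ(g)(E')`, with its reduced closed subscheme structure, is a regular scheme: a
blow-up `ρ₁ : T' → C'` of the reduced orbit `C'` of `E'` (regular: field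
`isRegular_subscheme_orbit`) in `C ∩ C'` (regular: `quasiSplitNormalFormPair_centreIntersection_orbit`)
is regular (`IsBlowup.isRegular_of_isRegular_subscheme`), maps into `X'` by a closed immersion
(`StrictTransformClosedImmersion_holds`) with image the strict transform of `C'`
(`IsBlowup.range_eq_strictTransformSet`), and the reduced closed subscheme on the image of a
closed immersion from a regular scheme is regular (`isRegular_subscheme_vanishingIdeal_range`).
(The hypothesis `E' ⊄ C` is not needed.) [cite: DeJong1996, 4.27, p. 75] [cite: DeJong1997, proof of Prop. 5.11, p. 619] -/
theorem quasiSplitNormalFormPair_isRegular_strictTransform_orbit {k : Type} [Field k]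
    {G : Type} [Group G] [Finite G] {X : Scheme.{0}} {p : X ⟶ Spec (.of k)} {ρ : G →* Aut X}
    {Z : Set X} {d : ℕ} (hP : DeJong1997.QuasiSplitNormalFormPair p Z ρ d)
    {E : Set ↥({x : X | ¬ IsRegularLocalRing (X.presheaf.stalk x)} : Set X)}
    (hE : E ∈ irreducibleComponents ↥({x : X | ¬ IsRegularLocalRing (X.presheaf.stalk x)} : Set X))
    {X' : Scheme.{0}} {π : X' ⟶ X}
    (hπ : IsBlowup π (Scheme.IdealSheafData.vanishingIdeal
      ⟨closure (⋃ g : G, (ρ g).hom.base '' (Subtype.val '' E)), isClosed_closure⟩))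
    (E' : Set X) (hE' : E' ∈ componentsIn ({x : X | ¬ IsRegularLocalRing (X.presheaf.stalk x)} : Set X)) :
    Scheme.IsRegular (Scheme.IdealSheafData.vanishingIdeal
      ⟨strictTransformSet π (closure (⋃ g : G, (ρ g).hom.base '' (Subtype.val '' E)))
          (⋃ g : G, (ρ g).hom.base '' E'),
        strictTransformSet.isClosed π _ _⟩).subscheme := by
  -- adapted from `DeJong1996NormalFormPairStrictTransformRegular.of_centreIntersection_of_strictTransform`
  have hS : IsClosed ({x : X | ¬ IsRegularLocalRing (X.presheaf.stalk x)} : Set X) :=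
    hP.isClosed_setOf_not_isRegularLocalRing
  haveI := hP.isIntegral
  haveI := hP.locallyOfFiniteType
  haveI : IsNoetherian X := hP.isNoetherian
  -- `E'` in subspace form and its closed orbit `C'`
  obtain ⟨E₁, hE₁, rfl⟩ := hE'
  have hC'eq : closure (⋃ g : G, (ρ g).hom.base '' (Subtype.val '' E₁)) =
      ⋃ g : G, (ρ g).hom.base '' (Subtype.val '' E₁) := quasiSplitNormalFormPair_closure_orbit_eq hP hE₁
  set I' : X.IdealSheafData := vanishingIdeal ⟨closure (⋃ g : G, (ρ g).hom.base '' (Subtype.val '' E₁)),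
    isClosed_closure⟩ with hI'def
  have hregC' : Scheme.IsRegular I'.subscheme := hP.isRegular_subscheme_orbit E₁ hE₁
  -- the blow-up of `C'` in `C ∩ C'` is regular
  obtain ⟨T', ρ₁, hρ₁⟩ := exists_isBlowup _
    ((vanishingIdeal (⟨closure (⋃ g : G, (ρ g).hom.base '' (Subtype.val '' E)), isClosed_closure⟩ :
      Closeds X)).comap I'.subschemeι)
  haveI : IsLocallyNoetherian I'.subscheme := LocallyOfFiniteType.isLocallyNoetherian I'.subschemeι
  have hJreg := quasiSplitNormalFormPair_centreIntersection_orbit hP hE hE₁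
  have hT'reg : Scheme.IsRegular T' := hρ₁.isRegular_of_isRegular_subscheme hregC' hJreg
  -- its closed immersion into `X'`, with image the strict transform of `C'`
  have hjπ := hπ.strictTransformHom_comp hρ₁
  haveI : IsClosedImmersion (hπ.strictTransformHom hρ₁) :=
    StrictTransformClosedImmersion_holds X X' _ T' _ _ π ρ₁ hπ hρ₁ (hπ.strictTransformHom hρ₁) hjπ
  have hrange : Set.range (hπ.strictTransformHom hρ₁) =
      strictTransformSet π (closure (⋃ g : G, (ρ g).hom.base '' (Subtype.val '' E)))
        (⋃ g : G, (ρ g).hom.base '' (Subtype.val '' E₁)) := by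
    rw [hπ.range_eq_strictTransformSet hρ₁ hjπ
      (hπ.strictTransformHom hρ₁).isClosedEmbedding.isClosed_range,
      Scheme.IdealSheafData.coe_support_vanishingIdeal,
      Scheme.IdealSheafData.range_subschemeι, Scheme.IdealSheafData.coe_support_vanishingIdeal]
    exact congrArg _ hC'eq
  have hreg := isRegular_subscheme_vanishingIdeal_range (hπ.strictTransformHom hρ₁) hT'reg
  have h2 : (⟨Set.range (hπ.strictTransformHom hρ₁),
      (hπ.strictTransformHom hρ₁).isClosedEmbedding.isClosed_range⟩ : Closeds X') =
      ⟨strictTransformSet π (closure (⋃ g : G, (ρ g).hom.base '' (Subtype.val '' E)))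
          (⋃ g : G, (ρ g).hom.base '' (Subtype.val '' E₁)),
        strictTransformSet.isClosed π _ _⟩ := Closeds.ext hrange
  rwa [h2] at hreg

/-- **(O2) with the binders of the stub** (`stub_pair_orbitNormalFormBlowup`): the hypothesis
`hO2` of `quasiSplitNormalFormPair_blowup_of_overCentre`, verbatim.
[cite: DeJong1996, 4.27, p. 75] [cite: DeJong1997, proof of Prop. 5.11, p. 619] -/
theorem stub_pair_orbitNormalFormBlowup_strictTransformOrbitRegular (k : Type) [Field k]
    (G : Type) [Group G] [Finite G] (X : Scheme.{0}) (p : X ⟶ Spec (.of k)) (ρ : G →* Aut X)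
    (Z : Set X) (d : ℕ) (hP : DeJong1997.QuasiSplitNormalFormPair p Z ρ d)
    (E : Set ↥({x : X | ¬ IsRegularLocalRing (X.presheaf.stalk x)} : Set X))
    (hE : E ∈ irreducibleComponents ↥({x : X | ¬ IsRegularLocalRing (X.presheaf.stalk x)} : Set X))
    (X' : Scheme.{0}) (π : X' ⟶ X)
    (hπ : IsBlowup π (Scheme.IdealSheafData.vanishingIdeal
      ⟨closure (⋃ g : G, (ρ g).hom.base '' (Subtype.val '' E)), isClosed_closure⟩)) :
    ∀ E' ∈ componentsIn ({x : X | ¬ IsRegularLocalRing (X.presheaf.stalk x)} : Set X),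
      ¬ E' ⊆ closure (⋃ g : G, (ρ g).hom.base '' (Subtype.val '' E)) →
        Scheme.IsRegular (Scheme.IdealSheafData.vanishingIdeal
          ⟨strictTransformSet π (closure (⋃ g : G, (ρ g).hom.base '' (Subtype.val '' E)))
              (⋃ g : G, (ρ g).hom.base '' E'),
            strictTransformSet.isClosed π _ _⟩).subscheme :=
  fun E' hE' _ => quasiSplitNormalFormPair_isRegular_strictTransform_orbit hP hE hπ E' hE'

end Summit.ResolutionOfSingularities.ResolutionOfSingularities.Theorems

end
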